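import Summits.HubbardSuperconductivity.HubbardSuperconductivity.Theses.AposterioriCapRg
import Summits.HubbardSuperconductivity.HubbardSuperconductivity.Theorems.AposterioriCapRgCapRgSymmetricCertificatePinnedStubDominanceOfMargins
import Literature.MathematicalPhysics.QuantumLattice.RayleighBottom

/-!
# Line `loewner-riccati-channel-sandwich` for crux `CapRgSymmetricCertificatePinned`
# (item stmt-HubbardSuperconductivity-14045, route AposterioriCapRg) — stub `stub_b1gReadout`

The read-out of the two SPECTRAL clauses of the symmetric-regime certificate from a Rayleigh sandwich.
Let `A` be a `D₄`-covariant matrix on the torus momenta and let `Am`, `Ap` sandwich its real Rayleigh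
quotient `q_X(g) = Re⟨g, X g⟩` pointwise, `q_{Am} ≤ q_A ≤ q_{Ap}`.  Four FINITE CHECKS on the comparison
matrices,
* (C1) a `B₁g` unit vector `f` with `q_{Ap}(f) ≤ -a` (`a > 0`),
* (C2) `q_{Am} ≥ -b` on unit vectors,
* (C3) `q_{Am} ≥ m > -a` on unit vectors orthogonal to all `B₁g` functions (strict isotypic gap),
* (C4) a unit vector `f₁` with `q_{Am} ≥ -a/2` on unit vectors orthogonal to `f₁` (half-bottom second
  level),
give `CooperDominance A` and the window `a ≤ λ_d(A) = (-A).supRayleigh ≤ b`.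

Proof (elementary bookkeeping with conditionally complete lattices; no spectral theory here).
With `λ := (-A).supRayleigh`:
* `a ≤ λ` from (C1) and `-λ ≤ q_A(f) ≤ q_{Ap}(f) ≤ -a` (`RayleighBottom.neg_supRayleigh_neg_le`);
* `λ ≤ b` termwise (`ciSup_le`): `-q_A(v) ≤ -q_{Am}(v) ≤ b` by (C2);
* the three hypotheses of the LANDED open-condition form `stub_dominanceOfMargins` (p85399):
  the strict gap `⨅_{B₁g units} q_A ≤ q_A(f) ≤ -a < m ≤ ⨅_{B₁g^⊥ units} q_A` ((C3); the `⨅` over an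
  empty subtype is the junk `0 > -a`), the negative bottom `-λ ≤ -a < 0`, and the half-bottom level
  `-λ/2 ≤ -a/2 ≤ ⨅_{g ⊥ f₁} q_A(g) ≤ ⨆_f ⨅_{g ⊥ f} q_A(g)` ((C4); all ranges bounded by the entry bound
  `|q_A| ≤ Σᵢⱼ ‖A i j‖` on unit vectors, `RayleighBottom.abs_reRayleigh_le`).
Sources: folklore (Rayleigh quotients; Courant–Fischer bookkeeping).
-/

noncomputable section

namespace Summit.HubbardSuperconductivity.CapRgSymmetricCertificatePinned.Loewner

open Literature.MathematicalPhysics.QuantumLattice Literature.Probability.LatticeModels Matrix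
open Literature.MathematicalPhysics.QuantumLattice.RayleighBottom
open Summit.HubbardSuperconductivity.CapRgSymmetricCertificatePinned.StrictContinuum
  (stub_dominanceOfMargins)
open scoped BigOperators ComplexOrder

/-- **Stub `stub_b1gReadout`** (read-out of the spectral clauses from a sandwich): let `A` be
`D₄`-covariant and let `Am`, `Ap` sandwich its real Rayleigh quotient, `q_{Am} ≤ q_A ≤ q_{Ap}`
pointwise.  If (C1) some `B₁g` unit vector has `q_{Ap} ≤ -a` (`a > 0`), (C2) `q_{Am} ≥ -b` on unit
vectors, (C3) `q_{Am} ≥ m > -a` on unit vectors orthogonal to `B₁g` (strict isotypic gap), and (C4)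
for some unit `f₁`, `q_{Am} ≥ -a/2` on unit vectors orthogonal to `f₁` (half-bottom second level),
then `A` has Cooper dominance (via the landed `stub_dominanceOfMargins`) and
`a ≤ λ_d(A) = (-A).supRayleigh ≤ b`. [folklore] -/
theorem stub_b1gReadout : ∀ (L : ℕ) [NeZero L] (A Am Ap : Matrix (TorusSite 2 L) (TorusSite 2 L) ℂ) (a b m : ℝ),
    0 < a → -a < m →
    (∀ (γ : DihedralGroup 4) (k k' : TorusSite 2 L), A (d4Site γ k) (d4Site γ k') = A k k') →
    (∀ g : TorusSite 2 L → ℂ, reRayleigh Am g ≤ reRayleigh A g) →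
    (∀ g : TorusSite 2 L → ℂ, reRayleigh A g ≤ reRayleigh Ap g) →
    (∃ f : TorusSite 2 L → ℂ, star f ⬝ᵥ f = 1 ∧ IsB1g f ∧ reRayleigh Ap f ≤ -a) →
    (∀ g : TorusSite 2 L → ℂ, star g ⬝ᵥ g = 1 → -b ≤ reRayleigh Am g) →
    (∀ g : TorusSite 2 L → ℂ, star g ⬝ᵥ g = 1 → (∀ f : TorusSite 2 L → ℂ, IsB1g f → star f ⬝ᵥ g = 0) →
      m ≤ reRayleigh Am g) →
    (∃ f₁ : TorusSite 2 L → ℂ, star f₁ ⬝ᵥ f₁ = 1 ∧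
      ∀ g : TorusSite 2 L → ℂ, star g ⬝ᵥ g = 1 → star f₁ ⬝ᵥ g = 0 → -a / 2 ≤ reRayleigh Am g) →
    CooperDominance A ∧ a ≤ (-A).supRayleigh ∧ (-A).supRayleigh ≤ b := by
  intro L _ A Am Ap a b m ha hm hcov hlo hhi hC1 hC2 hC3 hC4
  obtain ⟨f, hf, hfB, hfa⟩ := hC1
  obtain ⟨f₁, hf₁, hC4'⟩ := hC4
  -- (C1) + upper sandwich: the `B₁g` unit `f` has `q_A(f) ≤ -a`
  have hAf : reRayleigh A f ≤ -a := (hhi f).trans hfa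
  -- window, low end: `-λ ≤ q_A(f) ≤ -a`
  have hlow : a ≤ (-A).supRayleigh := by
    have h := neg_supRayleigh_neg_le A hf
    linarith
  -- window, high end: termwise `-q_A(v) ≤ -q_{Am}(v) ≤ b`
  have hhigh : (-A).supRayleigh ≤ b := by
    haveI : Nonempty {w : TorusSite 2 L → ℂ // star w ⬝ᵥ w = 1} := ⟨⟨f, hf⟩⟩
    refine ciSup_le fun w => ?_
    rw [Matrix.neg_mulVec, dotProduct_neg, Complex.neg_re]
    change -reRayleigh A w.1 ≤ b
    linarith [hC2 w.1 w.2, hlo w.1]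
  -- negative bottom
  have hneg : -(-A).supRayleigh < 0 := by linarith
  -- bounded ranges (entry bound on unit vectors)
  have hbddB : BddBelow (Set.range
      fun g : {g : TorusSite 2 L → ℂ // star g ⬝ᵥ g = 1 ∧ IsB1g g} => reRayleigh A g.1) :=
    ⟨-(∑ i, ∑ j, ‖A i j‖), by
      rintro _ ⟨g, rfl⟩
      exact neg_entry_sum_le_reRayleigh A g.2.1⟩
  have hbddO : ∀ f' : TorusSite 2 L → ℂ, BddBelow (Set.range
      fun g : {g : TorusSite 2 L → ℂ // star g ⬝ᵥ g = 1 ∧ star f' ⬝ᵥ g = 0} => reRayleigh A g.1) :=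
    fun f' => ⟨-(∑ i, ∑ j, ‖A i j‖), by
      rintro _ ⟨g, rfl⟩
      exact neg_entry_sum_le_reRayleigh A g.2.1⟩
  -- strict isotypic gap: `⨅_{B₁g} q_A ≤ q_A(f) ≤ -a < m ≤ ⨅_{B₁g^⊥} q_A`
  have hgap : (⨅ f : {f : TorusSite 2 L → ℂ // star f ⬝ᵥ f = 1 ∧ IsB1g f}, reRayleigh A f.1) <
      ⨅ g : {g : TorusSite 2 L → ℂ // star g ⬝ᵥ g = 1 ∧
        ∀ f : TorusSite 2 L → ℂ, IsB1g f → star f ⬝ᵥ g = 0}, reRayleigh A g.1 := by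
    have hL : (⨅ f : {f : TorusSite 2 L → ℂ // star f ⬝ᵥ f = 1 ∧ IsB1g f}, reRayleigh A f.1) ≤ -a :=
      (ciInf_le hbddB ⟨f, hf, hfB⟩).trans hAf
    have hR : -a < ⨅ g : {g : TorusSite 2 L → ℂ // star g ⬝ᵥ g = 1 ∧
        ∀ f : TorusSite 2 L → ℂ, IsB1g f → star f ⬝ᵥ g = 0}, reRayleigh A g.1 := by
      rcases isEmpty_or_nonempty {g : TorusSite 2 L → ℂ // star g ⬝ᵥ g = 1 ∧
          ∀ f : TorusSite 2 L → ℂ, IsB1g f → star f ⬝ᵥ g = 0} with hE | hN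
      · rw [Real.iInf_of_isEmpty]
        linarith
      · exact hm.trans_le (le_ciInf fun g => (hC3 g.1 g.2.1 g.2.2).trans (hlo g.1))
    exact hL.trans_lt hR
  -- half-bottom level: `-λ/2 ≤ -a/2 ≤ ⨅_{g ⊥ f₁} q_A(g) ≤ ⨆_f ⨅_{g ⊥ f} q_A(g)`
  have hhalf : -(-A).supRayleigh / 2 ≤ ⨆ f : {f : TorusSite 2 L → ℂ // star f ⬝ᵥ f = 1},
      ⨅ g : {g : TorusSite 2 L → ℂ // star g ⬝ᵥ g = 1 ∧ star f.1 ⬝ᵥ g = 0}, reRayleigh A g.1 := by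
    have hbddA : BddAbove (Set.range fun f' : {f : TorusSite 2 L → ℂ // star f ⬝ᵥ f = 1} =>
        ⨅ g : {g : TorusSite 2 L → ℂ // star g ⬝ᵥ g = 1 ∧ star f'.1 ⬝ᵥ g = 0}, reRayleigh A g.1) := by
      refine ⟨∑ i, ∑ j, ‖A i j‖, ?_⟩
      rintro _ ⟨f', rfl⟩
      rcases isEmpty_or_nonempty
          {g : TorusSite 2 L → ℂ // star g ⬝ᵥ g = 1 ∧ star f'.1 ⬝ᵥ g = 0} with hE | hN
      · show (⨅ g : {g : TorusSite 2 L → ℂ // star g ⬝ᵥ g = 1 ∧ star f'.1 ⬝ᵥ g = 0},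
          reRayleigh A g.1) ≤ ∑ i, ∑ j, ‖A i j‖
        rw [Real.iInf_of_isEmpty]
        positivity
      · obtain ⟨g⟩ := hN
        exact (ciInf_le (hbddO f'.1) g).trans ((le_abs_self _).trans (abs_reRayleigh_le A g.2.1))
    have hinner : -a / 2 ≤
        ⨅ g : {g : TorusSite 2 L → ℂ // star g ⬝ᵥ g = 1 ∧ star f₁ ⬝ᵥ g = 0}, reRayleigh A g.1 := by
      rcases isEmpty_or_nonempty
          {g : TorusSite 2 L → ℂ // star g ⬝ᵥ g = 1 ∧ star f₁ ⬝ᵥ g = 0} with hE | hN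
      · rw [Real.iInf_of_isEmpty]
        linarith
      · exact le_ciInf fun g => (hC4' g.1 g.2.1 g.2.2).trans (hlo g.1)
    calc -(-A).supRayleigh / 2 ≤ -a / 2 := by linarith
      _ ≤ ⨅ g : {g : TorusSite 2 L → ℂ // star g ⬝ᵥ g = 1 ∧ star f₁ ⬝ᵥ g = 0}, reRayleigh A g.1 :=
          hinner
      _ ≤ ⨆ f : {f : TorusSite 2 L → ℂ // star f ⬝ᵥ f = 1},
          ⨅ g : {g : TorusSite 2 L → ℂ // star g ⬝ᵥ g = 1 ∧ star f.1 ⬝ᵥ g = 0}, reRayleigh A g.1 :=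
          le_ciSup hbddA ⟨f₁, hf₁⟩
  exact ⟨stub_dominanceOfMargins L A hcov hgap hneg hhalf, hlow, hhigh⟩

end Summit.HubbardSuperconductivity.CapRgSymmetricCertificatePinned.Loewner

end
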